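import Summits.Ventures.PercRepro.S1ConeTwoFibres

/-!
# PercRepro — THE CANDIDATES THROUGH A POINT ON TWO TRIANGLES: AT MOST `34` (p2, gen 25; SUBCLAIM-S1 §6.9 (xii) T3)

On a `10`-point matroid with (C1), (C2) and circuits of size `≥ 3`, let `x` lie on exactly the two triangles
`L₁, L₂` (cone `5` points, outside `O` of `5` points). The CANDIDATES — `4`-sets `K ∋ x` of rank `3` containing
neither line — number at most `34`: a candidate has at most one point on each `Lᵢ ∖ x`, so it takes `1`, `2` or `3`
outside points; with one outside point it has a point on each line and the outside point is determined (`≤ 4`,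
S1ConeTwoFibres); with two outside points `s, t` its cone point lies on one line (`≤ 2` per pair, `≤ 20`); with
three it is `{x} ∪ B`, `B` a `3`-subset of `O` (`≤ C(5, 3) = 10`). Hence
**`#{four-circuits ∋ x} + #{triangles ∌ x} ≤ 34`**.

* **`ncard_fourCircuits_through_add_triangles_avoiding_le_two`** — the theorem.
Axioms: standard.
-/

open scoped Matroid

namespace PercRepro

namespace S1

open Set

variable {α : Type}

open Classical in
/-- **AT MOST `34` CANDIDATES THROUGH A POINT ON EXACTLY TWO TRIANGLES** of a `10`-point matroid with (C1), (C2)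
and circuits of size `≥ 3`: `#{four-circuits ∋ x} + #{triangles ∌ x} ≤ 34`. -/
theorem ncard_fourCircuits_through_add_triangles_avoiding_le_two (N : Matroid α) [N.Finite]
    (hC1 : ∀ L ⊆ N.E, N.eRk L = 2 → L.ncard ≤ 3) (hC2 : ∀ P ⊆ N.E, N.eRk P ≤ 3 → P.ncard ≤ 6)
    (hcirc : ∀ C, N.IsCircuit C → 3 ≤ C.ncard) {x : α} (hn : N.E.ncard = 10)
    {L₁ L₂ : Set α} (hL₁ : L₁ ∈ ThmN.trianglesThrough N x) (hL₂ : L₂ ∈ ThmN.trianglesThrough N x)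
    (h12 : L₁ ≠ L₂) (hall : ∀ C ∈ ThmN.trianglesThrough N x, C = L₁ ∨ C = L₂) :
    {C : Set α | N.IsCircuit C ∧ C.ncard = 4 ∧ x ∈ C}.ncard +
      {C : Set α | N.IsCircuit C ∧ C.ncard = 3 ∧ x ∉ C}.ncard ≤ 34 := by
  have hEfin : N.E.Finite := N.ground_finite
  have hL₁E := hL₁.1.subset_ground
  have hL₂E := hL₂.1.subset_ground
  have hxE : x ∈ N.E := hL₁E hL₁.2.2
  have hconeE : L₁ ∪ L₂ ⊆ N.E := Set.union_subset hL₁E hL₂E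
  have hconefin : (L₁ ∪ L₂).Finite := hEfin.subset hconeE
  have hcone5 : (L₁ ∪ L₂).ncard = 5 := ncard_union_eq_five_of_trianglesThrough N hC1 hL₁ hL₂ h12
  set O := N.E \ (L₁ ∪ L₂) with hO
  have hO5 : O.ncard = 5 := by rw [hO, Set.ncard_sdiff hconeE hconefin, hn, hcone5]
  have hOfin : O.Finite := hEfin.subset sdiff_subset
  have hOE : O ⊆ N.E := sdiff_subset
  have hOx : x ∉ O := fun h => h.2 (Or.inl hL₁.2.2)
  have hnotri : ∀ s ∈ O, ∀ C ∈ ThmN.trianglesThrough N x, s ∉ C := by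
    intro s hs C hC hsC
    rcases hall C hC with rfl | rfl
    · exact hs.2 (Or.inl hsC)
    · exact hs.2 (Or.inr hsC)
  -- the candidates
  set 𝒦 := {K : Set α | K ⊆ N.E ∧ x ∈ K ∧ K.ncard = 4 ∧ N.eRk K = 3 ∧ ¬ L₁ ⊆ K ∧ ¬ L₂ ⊆ K} with h𝒦
  have h𝒦fin : 𝒦.Finite := hEfin.finite_subsets.subset (fun K hK => hK.1)
  have h𝒦spec : ∀ K ∈ 𝒦, K ⊆ N.E ∧ x ∈ K ∧ K.ncard = 4 ∧ N.eRk K = 3 ∧ ¬ L₁ ⊆ K ∧ ¬ L₂ ⊆ K :=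
    fun K hK => hK
  have hfinE : ∀ X ⊆ N.E, N.eRk X ≠ ⊤ := fun X hX =>
    ((N.eRk_le_encard X).trans_lt (hEfin.subset hX).encard_lt_top).ne
  ----------------------------------------------------------------
  -- (1) the four-circuits through `x` and the sets `{x} ∪ T` are candidates
  ----------------------------------------------------------------
  set A := {C : Set α | N.IsCircuit C ∧ C.ncard = 4 ∧ x ∈ C} with hA
  set 𝒯' := {C : Set α | N.IsCircuit C ∧ C.ncard = 3 ∧ x ∉ C} with h𝒯'
  have hA𝒦 : A ⊆ 𝒦 := by
    rintro C ⟨hC, h4, hxC⟩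
    have hCE := hC.subset_ground
    have hCfin : C.Finite := hEfin.subset hCE
    refine ⟨hCE, hxC, h4, ?_, ?_, ?_⟩
    · have h := hC.eRk_add_one_eq
      rw [← hCfin.cast_ncard_eq, h4] at h
      obtain ⟨r, hr⟩ := ENat.ne_top_iff_exists.1 (hfinE C hCE)
      rw [← hr] at h ⊢
      have : r + 1 = 4 := by exact_mod_cast h
      norm_cast; omega
    · intro hsub
      have h := hL₁.1.eq_of_subset_isCircuit hC hsub
      have h3 := hL₁.2.1
      rw [h] at h3; omega
    · intro hsub
      have h := hL₂.1.eq_of_subset_isCircuit hC hsub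
      have h3 := hL₂.2.1
      rw [h] at h3; omega
  have hB𝒦 : (insert x) '' 𝒯' ⊆ 𝒦 := by
    rintro K ⟨T, ⟨hT, hT3, hxT⟩, rfl⟩
    have hTE := hT.subset_ground
    have hTfin : T.Finite := hEfin.subset hTE
    have hTr : N.eRk T = 2 := by
      have h := hT.eRk_add_one_eq
      rw [← hTfin.cast_ncard_eq, hT3] at h
      obtain ⟨r, hr⟩ := ENat.ne_top_iff_exists.1 (hfinE T hTE)
      rw [← hr] at h ⊢
      have : r + 1 = 3 := by exact_mod_cast h
      norm_cast; omega
    have hnoL : ∀ L ∈ ThmN.trianglesThrough N x, ¬ L ⊆ insert x T := by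
      intro L hL hsub
      have h2 : (L \ {x}).ncard = 2 := by rw [Set.ncard_sdiff_singleton_of_mem hL.2.2, hL.2.1]
      obtain ⟨y, z, hyz, hyz'⟩ := Set.ncard_eq_two.1 h2
      have hy : y ∈ L \ {x} := by rw [hyz']; simp
      have hz : z ∈ L \ {x} := by rw [hyz']; simp
      have hyT : y ∈ T := by
        rcases hsub hy.1 with h | h
        · exact absurd h hy.2
        · exact h
      have hzT : z ∈ T := by
        rcases hsub hz.1 with h | h
        · exact absurd h hz.2
        · exact h
      have hTy : T ∈ ThmN.trianglesThrough N y := ⟨hT, hT3, hyT⟩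
      have hLy : L ∈ ThmN.trianglesThrough N y := ⟨hL.1, hL.2.1, hy.1⟩
      have hneTL : T ≠ L := fun h => hxT (h ▸ hL.2.2)
      have hint := ThmN.inter_eq_singleton_of_mem_trianglesThrough N hC1 hTy hLy hneTL
      have : z ∈ T ∩ L := ⟨hzT, hz.1⟩
      rw [hint] at this
      exact hyz (Set.mem_singleton_iff.1 this).symm
    refine ⟨Set.insert_subset hxE hTE, Set.mem_insert x T, ?_, ?_, hnoL L₁ hL₁, hnoL L₂ hL₂⟩
    · rw [Set.ncard_insert_of_notMem hxT hTfin, hT3]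
    · have hle : N.eRk (insert x T) ≤ 3 := by
        calc N.eRk (insert x T) ≤ N.eRk T + 1 := N.eRk_insert_le_add_one x T
          _ = 3 := by rw [hTr]; rfl
      obtain ⟨r, hr⟩ := ENat.ne_top_iff_exists.1 (hfinE _ (Set.insert_subset hxE hTE))
      have hr3 : r ≤ 3 := by rw [← hr] at hle; exact_mod_cast hle
      have hr2 : ¬ r ≤ 2 := by
        intro hr2
        have hle2 : N.eRk (insert x T) ≤ N.eRk T := by
          rw [← hr, hTr]; exact_mod_cast hr2
        have := mem_closure_of_eRk_insert_le N hTE hxE hle2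
        rw [closure_eq_of_triangle N hC1 hT hT3] at this
        exact hxT this
      rw [← hr]
      norm_cast; omega
  have hdisj : Disjoint A ((insert x) '' 𝒯') := by
    rw [Set.disjoint_left]
    rintro K ⟨hK, -, -⟩ ⟨T, ⟨hT, -, hxT⟩, rfl⟩
    exact hK.not_ssubset hT (Set.ssubset_insert hxT)
  have hAfin : A.Finite := (finite_fourCircuits N).subset (fun C hC => ⟨hC.1, hC.2.1⟩)
  have h𝒯'fin : 𝒯'.Finite := (finite_triangles N).subset (fun C hC => ⟨hC.1, hC.2.1⟩)
  have hBcard : ((insert x) '' 𝒯').ncard = 𝒯'.ncard := by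
    apply Set.InjOn.ncard_image
    rintro T ⟨-, -, hxT⟩ T' ⟨-, -, hxT'⟩ h
    ext y
    constructor
    · intro hy
      have : y ∈ insert x T' := h ▸ Set.mem_insert_of_mem x hy
      rcases this with rfl | h'
      · exact absurd hy hxT
      · exact h'
    · intro hy
      have : y ∈ insert x T := h ▸ Set.mem_insert_of_mem x hy
      rcases this with rfl | h'
      · exact absurd hy hxT'
      · exact h'
  have hstep1 : A.ncard + 𝒯'.ncard ≤ 𝒦.ncard := by
    rw [← hBcard, ← Set.ncard_union_eq hdisj hAfin (h𝒯'fin.image _)]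
    exact Set.ncard_le_ncard (Set.union_subset hA𝒦 hB𝒦) h𝒦fin
  refine hstep1.trans ?_
  ----------------------------------------------------------------
  -- (2) the candidates number at most `34`, by the number of outside points
  ----------------------------------------------------------------
  -- at most one point of a candidate on each line; the outside trace has `1`, `2` or `3` points
  have hline : ∀ K ∈ 𝒦, (K ∩ (L₁ \ {x})).ncard ≤ 1 ∧ (K ∩ (L₂ \ {x})).ncard ≤ 1 := by
    intro K hK
    obtain ⟨hKE, hxK, hK4, hKr, hL₁K, hL₂K⟩ := h𝒦spec K hK
    constructor
    · rw [Set.ncard_le_one_iff (hEfin.subset (Set.inter_subset_left.trans hKE))]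
      rintro y z ⟨hyK, hyL, hyx⟩ ⟨hzK, hzL, hzx⟩
      by_contra hyz
      exact not_two_of_line hL₁ hxK hL₁K hyK hzK hyz (fun h => hyx (Set.mem_singleton_iff.2 h))
        (fun h => hzx (Set.mem_singleton_iff.2 h)) hyL hzL
    · rw [Set.ncard_le_one_iff (hEfin.subset (Set.inter_subset_left.trans hKE))]
      rintro y z ⟨hyK, hyL, hyx⟩ ⟨hzK, hzL, hzx⟩
      by_contra hyz
      exact not_two_of_line hL₂ hxK hL₂K hyK hzK hyz (fun h => hyx (Set.mem_singleton_iff.2 h))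
        (fun h => hzx (Set.mem_singleton_iff.2 h)) hyL hzL
  have htrace : ∀ K ∈ 𝒦, (K \ {x}).ncard = 3 ∧ (K ∩ O).ncard + (K ∩ (L₁ \ {x})).ncard +
      (K ∩ (L₂ \ {x})).ncard = 3 := by
    intro K hK
    obtain ⟨hKE, hxK, hK4, -, -, -⟩ := h𝒦spec K hK
    have hKfin : K.Finite := hEfin.subset hKE
    have h3 : (K \ {x}).ncard = 3 := by rw [Set.ncard_sdiff_singleton_of_mem hxK, hK4]
    refine ⟨h3, ?_⟩
    -- `K ∖ x` is the disjoint union of the three traces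
    have hunion : K \ {x} = (K ∩ O) ∪ ((K ∩ (L₁ \ {x})) ∪ (K ∩ (L₂ \ {x}))) := by
      ext y
      simp only [Set.mem_sdiff, Set.mem_singleton_iff, Set.mem_union, Set.mem_inter_iff, hO]
      constructor
      · rintro ⟨hyK, hyx⟩
        by_cases h1 : y ∈ L₁
        · exact Or.inr (Or.inl ⟨hyK, h1, hyx⟩)
        by_cases h2 : y ∈ L₂
        · exact Or.inr (Or.inr ⟨hyK, h2, hyx⟩)
        · exact Or.inl ⟨hyK, hKE hyK, fun h => h.elim h1 h2⟩
      · rintro (⟨hyK, -, hyc⟩ | ⟨hyK, -, hyx⟩ | ⟨hyK, -, hyx⟩)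
        · exact ⟨hyK, fun h => hyc (Or.inl (h ▸ hL₁.2.2))⟩
        · exact ⟨hyK, hyx⟩
        · exact ⟨hyK, hyx⟩
    have hd1 : Disjoint (K ∩ O) ((K ∩ (L₁ \ {x})) ∪ (K ∩ (L₂ \ {x}))) := by
      rw [Set.disjoint_left]
      rintro y ⟨-, hyO⟩ (⟨-, hyL, -⟩ | ⟨-, hyL, -⟩)
      · exact hyO.2 (Or.inl hyL)
      · exact hyO.2 (Or.inr hyL)
    have hd2 : Disjoint (K ∩ (L₁ \ {x})) (K ∩ (L₂ \ {x})) := by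
      rw [Set.disjoint_left]
      rintro y ⟨-, hy1, hyx⟩ ⟨-, hy2, -⟩
      have hint := ThmN.inter_eq_singleton_of_mem_trianglesThrough N hC1 hL₁ hL₂ h12
      have : y ∈ L₁ ∩ L₂ := ⟨hy1, hy2⟩
      rw [hint] at this
      exact hyx this
    rw [hunion, Set.ncard_union_eq hd1 (hKfin.subset Set.inter_subset_left)
      ((hKfin.subset Set.inter_subset_left).union (hKfin.subset Set.inter_subset_left)),
      Set.ncard_union_eq hd2 (hKfin.subset Set.inter_subset_left) (hKfin.subset Set.inter_subset_left)] at h3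
    omega
  -- the three pieces
  set G₁ := {K ∈ 𝒦 | (K ∩ O).ncard = 1} with hG₁
  set G₂ := {K ∈ 𝒦 | (K ∩ O).ncard = 2} with hG₂
  set G₃ := {K ∈ 𝒦 | (K ∩ O).ncard = 3} with hG₃
  have hcov : 𝒦 ⊆ G₁ ∪ G₂ ∪ G₃ := by
    intro K hK
    obtain ⟨-, ht⟩ := htrace K hK
    obtain ⟨h1, h2⟩ := hline K hK
    have : (K ∩ O).ncard = 1 ∨ (K ∩ O).ncard = 2 ∨ (K ∩ O).ncard = 3 := by omega
    rcases this with h | h | h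
    · exact Or.inl (Or.inl ⟨hK, h⟩)
    · exact Or.inl (Or.inr ⟨hK, h⟩)
    · exact Or.inr ⟨hK, h⟩
  -- `G₁ ⊆ F`: a point on each line
  have hG₁c : G₁.ncard ≤ 4 := by
    have hsub : G₁ ⊆ {K ∈ 𝒦 | ∃ a ∈ K, a ∈ L₁ ∧ a ≠ x ∧ ∃ b ∈ K, b ∈ L₂ ∧ b ≠ x} := by
      rintro K ⟨hK, hK1⟩
      obtain ⟨-, ht⟩ := htrace K hK
      obtain ⟨h1, h2⟩ := hline K hK
      have e1 : (K ∩ (L₁ \ {x})).ncard = 1 := by omega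
      have e2 : (K ∩ (L₂ \ {x})).ncard = 1 := by omega
      obtain ⟨a, ha⟩ := Set.ncard_eq_one.1 e1
      obtain ⟨b, hb⟩ := Set.ncard_eq_one.1 e2
      have haK : a ∈ K ∩ (L₁ \ {x}) := by rw [ha]; exact Set.mem_singleton a
      have hbK : b ∈ K ∩ (L₂ \ {x}) := by rw [hb]; exact Set.mem_singleton b
      exact ⟨hK, a, haK.1, haK.2.1, fun h => haK.2.2 (Set.mem_singleton_iff.2 h), b, hbK.1, hbK.2.1,
        fun h => hbK.2.2 (Set.mem_singleton_iff.2 h)⟩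
    exact (Set.ncard_le_ncard hsub (h𝒦fin.subset (fun K hK => hK.1))).trans
      (ncard_candidates_two_lines_le_four' N hC1 hC2 hL₁ hL₂ h12 𝒦 h𝒦spec)
  -- `G₃`: `K = {x} ∪ B` with `B` a `3`-subset of `O`
  have hG₃c : G₃.ncard ≤ 10 := by
    have hsubs : {B : Set α | B ⊆ O ∧ B.ncard = 3}.ncard = 10 := by
      rw [ncard_subsets_eq_choose O hOfin 3, hO5]; rfl
    rw [← hsubs]
    refine Set.ncard_le_ncard_of_injOn (fun K => K ∩ O) ?_ ?_ (hOfin.finite_subsets.subset (fun B hB => hB.1))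
    · rintro K ⟨hK, hK3⟩
      exact ⟨Set.inter_subset_right, hK3⟩
    · rintro K ⟨hK, hK3⟩ K' ⟨hK', hK'3⟩ heq
      obtain ⟨hKE, hxK, hK4, -, -, -⟩ := h𝒦spec K hK
      obtain ⟨hK'E, hxK', hK'4, -, -, -⟩ := h𝒦spec K' hK'
      have hKfin : K.Finite := hEfin.subset hKE
      have hK'fin : K'.Finite := hEfin.subset hK'E
      -- `K ∖ x = K ∩ O` (both have `3` points, `K ∩ O ⊆ K ∖ x`)
      have hKO : K ∩ O = K \ {x} := by
        refine Set.eq_of_subset_of_ncard_le (fun y hy => ⟨hy.1, fun h => hOx (Set.mem_singleton_iff.1 h ▸ hy.2)⟩) ?_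
          (hKfin.subset sdiff_subset)
        rw [hK3, Set.ncard_sdiff_singleton_of_mem hxK, hK4]
      have hK'O : K' ∩ O = K' \ {x} := by
        refine Set.eq_of_subset_of_ncard_le (fun y hy => ⟨hy.1, fun h => hOx (Set.mem_singleton_iff.1 h ▸ hy.2)⟩) ?_
          (hK'fin.subset sdiff_subset)
        rw [hK'3, Set.ncard_sdiff_singleton_of_mem hxK', hK'4]
      simp only at heq
      rw [hKO, hK'O] at heq
      calc K = insert x (K \ {x}) := by rw [Set.insert_sdiff_singleton, Set.insert_eq_of_mem hxK]
        _ = insert x (K' \ {x}) := by rw [heq]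
        _ = K' := by rw [Set.insert_sdiff_singleton, Set.insert_eq_of_mem hxK']
  -- `G₂`: the fibres of `K ↦ K ∩ O` over the `2`-subsets of `O` have at most `2` members
  have hG₂c : G₂.ncard ≤ 20 := by
    have hG₂fin : G₂.Finite := h𝒦fin.subset (fun K hK => hK.1)
    rw [Set.ncard_eq_toFinset_card G₂ hG₂fin]
    set F := hG₂fin.toFinset with hF
    have hmemF : ∀ K, K ∈ F ↔ K ∈ G₂ := fun K => Set.Finite.mem_toFinset _
    have hfib : ∀ B ∈ F.image (fun K => K ∩ O), (F.filter (fun K => K ∩ O = B)).card ≤ 2 := by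
      intro B hB
      obtain ⟨K₀, hK₀, hB₀⟩ := Finset.mem_image.1 hB
      obtain ⟨hK₀𝒦, hK₀2⟩ := (hmemF K₀).1 hK₀
      have hB2 : B.ncard = 2 := by rw [← hB₀]; exact hK₀2
      obtain ⟨s, t, hst, hBeq⟩ := Set.ncard_eq_two.1 hB2
      have hsO : s ∈ O := by
        have : s ∈ K₀ ∩ O := by rw [hB₀, hBeq]; simp
        exact this.2
      have htO : t ∈ O := by
        have : t ∈ K₀ ∩ O := by rw [hB₀, hBeq]; simp
        exact this.2
      have hpair := ncard_candidates_pair_le_two' N hC1 hC2 hcirc hL₁ hL₂ 𝒦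
        (fun K hK => ⟨hK.1, hK.2.1, hK.2.2.1, hK.2.2.2.1⟩) (hOE hsO) (hOE htO) hst hsO.2 htO.2 (hnotri s hsO)
      refine le_trans ?_ hpair
      rw [← Set.ncard_coe_finset]
      refine Set.ncard_le_ncard ?_ (h𝒦fin.subset (fun K hK => hK.1))
      intro K hK
      rw [Finset.coe_filter] at hK
      obtain ⟨hKF, hKB⟩ := hK
      obtain ⟨hK𝒦, hK2⟩ := (hmemF K).1 hKF
      have hsK : s ∈ K := by
        have : s ∈ K ∩ O := by rw [hKB, hBeq]; simp
        exact this.1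
      have htK : t ∈ K := by
        have : t ∈ K ∩ O := by rw [hKB, hBeq]; simp
        exact this.1
      -- the cone point: `K ∖ x` has `3` points, only `2` of them outside
      obtain ⟨h3, ht'⟩ := htrace K hK𝒦
      have : ∃ a ∈ K \ {x}, a ∉ K ∩ O := by
        by_contra hcon
        push Not at hcon
        have hsub : K \ {x} ⊆ K ∩ O := fun a ha => hcon a ha
        have := Set.ncard_le_ncard hsub (hEfin.subset (Set.inter_subset_left.trans (h𝒦spec K hK𝒦).1))
        omega
      obtain ⟨a, ⟨haK, hax⟩, haO⟩ := this
      have hacone : a ∈ L₁ ∪ L₂ := by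
        by_contra h
        exact haO ⟨haK, (h𝒦spec K hK𝒦).1 haK, h⟩
      exact ⟨hK𝒦, hsK, htK, a, haK, hacone, fun h => hax (Set.mem_singleton_iff.2 h)⟩
    have himg : (F.image (fun K => K ∩ O)).card ≤ 10 := by
      have hsubs : {B : Set α | B ⊆ O ∧ B.ncard = 2}.ncard = 10 := by
        rw [ncard_subsets_eq_choose O hOfin 2, hO5]; rfl
      rw [← hsubs, ← Set.ncard_coe_finset]
      refine Set.ncard_le_ncard ?_ (hOfin.finite_subsets.subset (fun B hB => hB.1))
      intro B hB
      rw [Finset.coe_image] at hB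
      obtain ⟨K, hK, rfl⟩ := hB
      obtain ⟨-, hK2⟩ := (hmemF K).1 (Finset.mem_coe.1 hK)
      exact ⟨Set.inter_subset_right, hK2⟩
    calc F.card ≤ 2 * (F.image (fun K => K ∩ O)).card := Finset.card_le_mul_card_image F 2 hfib
      _ ≤ 2 * 10 := by omega
  have hfinU : (G₁ ∪ G₂ ∪ G₃).Finite :=
    ((h𝒦fin.subset (fun K hK => hK.1)).union (h𝒦fin.subset (fun K hK => hK.1))).union
      (h𝒦fin.subset (fun K hK => hK.1))
  have hU1 := Set.ncard_union_le G₁ G₂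
  have hU2 := Set.ncard_union_le (G₁ ∪ G₂) G₃
  have := Set.ncard_le_ncard hcov hfinU
  omega

end S1

end PercRepro
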